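import Literature.AlgebraicGeometry.Frobenioids.ModelFrobenioidPreSteps
import Literature.AnabelianGeometry.EtaleTheta.BiKummer

/-!
# [EtTh] §4: fraction-pairs are determined by `f` up to a unique isomorphism — the content of
# Proposition 4.2 (i), (ii) over Definition 4.1 (i), proved for the model Frobenioid

Mochizuki, *The étale theta function …*, Publ. RIMS **45** (2009), §4, Prop. 4.2 (i)(ii) and its proof,
PDF pp. 88–89 (printed 314–315) [cite: MochizukiEtTh2009, Prop 4.2 p.88]: "(i) A pair of morphisms
`t', t'' : A → C` is a right fraction-pair for `f` if and only if there exists a [necessarily unique]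
isomorphism `v : B ⥲ C` such that `t' = v ∘ s'`, `t'' = v ∘ s''`. (ii) A pair of morphisms
`t', t'' : C → B` is a left fraction-pair for `f|_B` if and only if there exists a [necessarily unique]
isomorphism `v : C ⥲ A` such that `t' = s' ∘ v`, `t'' = s'' ∘ v`."  Printed proof (p.89): sufficiency
is immediate; for necessity "the 'disjoint supports' condition … implies the existence of isomorphisms
`v, v'''` … [[FrdI] Def. 1.3 (iii)(d)]; since `t', t''` are base-equivalent, `v = v'' ∘ v'''` for some
`v'' ∈ O^×(C)`; since the fraction-pair `t', t''` determines the same element of `O^×(A^birat)` as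
`s', s''`, `v'' = 1`; uniqueness from total epimorphicity [(ii): pre-steps are monomorphisms]."

abc-iut cell, layer L2, ROW `EtTh:Prop4.2` (seat abc-iut-L6-t12, L2-lead 2026-08-25T21:22:08Z).  The
statements are proved here over abc-iut-L2-t3's §4 setting `S : BiKummerSetting X T D VD`
(`BiKummer.lean`, Def. 4.1 (i) `FractionPair`), whose Frobenioid `C = S.tf.category` IS the model
Frobenioid of [FrdI] Thm. 5.2 (i), but whose BIRATIONAL vocabulary (`biratUnits`, `fracOf`,
`restrictAlong`, `DisjointSupports`) is abstract data.  The hypotheses are therefore exactly the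
[FrdI] facts the printed proof uses, in the following form:
* `hΦd`, `hBg`: `Φ` divisorial, `B` group-like (objectwise) — the hypotheses of [FrdI] Thm. 5.2 (ii)
  under which `C` is a Frobenioid (Def. 3.6 (i)(ii): `Φ` perf-factorial, `B₀^Λ` a group);
* a DICTIONARY `toB : O^×(A^birat) → B(A_D)^×`, injective, computing the fraction
  (`toB (s' · (s'')⁻¹) · u_{s''} = u_{s'}`) and compatible with restriction along pre-steps
  (`Base(s)^* toB(f|_B) = toB(f)`) — this is [FrdI] Thm. 5.2 (ii) "`O^×(−)` on `C^birat` is `B(−)`",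
  which abc-iut-L2-t9's `BiKummerSetting.mkOfModel` realises with `toB = id`;
* the two properties of "disjoint supports" ([FrdI] Prop. 4.1 (iii): supports of elements of a
  perf-factorial monoid) that the bracket "[Thus, `Div(s')`, `Div(s'')` are uniquely determined by
  `f`.]" of Def. 4.1 (i) uses: cancellation (`hDS`) and transport along base-isomorphisms (`hDSι`).
Nothing here asserts that such data exist for an actual curve; typed ≠ proved for Prop. 4.2 (iii)(iv).
-/

noncomputable section

namespace Literature.AlgebraicGeometry.Frobenioids

namespace ModelFrobenioid

open CategoryTheory Opposite

universe w v u

variable {D : Type u} [Category.{v} D] {Φ B : Dᵒᵖ ⥤ CommMonCat.{w}} {DivB : B ⟶ monoidGp Φ}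
  {X Y : ModelFrobenioid Φ B DivB}

/-- **The divisor of a fraction** ([EtTh] Def. 4.1 (i): zero divisor minus divisor of poles): for a
base-equivalent pair of linear morphisms `s', s'' : X → Y` and any `x ∈ B(Base X)` with
`x · u_{s''} = u_{s'}` (the fraction `s' · (s'')⁻¹` computed in `B`), `Div_B(x) + Div(s'') = Div(s')` in
`Φ(Base X)^gp` (subtract the relations (d) of [FrdI] Thm. 5.2 (i)). [cite: MochizukiFrdI2008, Thm. 5.2(ii) p.101] -/
theorem divB_mul_of_div_eq_of_mul_unit_eq (s' s'' : X ⟶ Y) (hb : baseMap s' = baseMap s'')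
    (h' : degFr s' = 1) (h'' : degFr s'' = 1) {x : B.obj (op X.base)} (hx : x * unit s'' = unit s') :
    divB Φ B DivB (op X.base) x * Algebra.GrothendieckGroup.of (div s'') =
      Algebra.GrothendieckGroup.of (div s') := by
  have e1 := rel s'
  have e2 := rel s''
  rw [h', PNat.one_coe, pow_one, ← hx, map_mul] at e1
  rw [h'', PNat.one_coe, pow_one, ← hb] at e2
  apply mul_left_cancel (a := X.cls)
  calc X.cls * (divB Φ B DivB (op X.base) x * Algebra.GrothendieckGroup.of (div s''))
      = divB Φ B DivB (op X.base) x * (X.cls * Algebra.GrothendieckGroup.of (div s'')) :=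
        mul_left_comm _ _ _
    _ = divB Φ B DivB (op X.base) x *
          (pullGp Φ (baseMap s') Y.cls * divB Φ B DivB (op X.base) (unit s'')) := by rw [e2]
    _ = pullGp Φ (baseMap s') Y.cls *
          (divB Φ B DivB (op X.base) x * divB Φ B DivB (op X.base) (unit s'')) := mul_left_comm _ _ _
    _ = X.cls * Algebra.GrothendieckGroup.of (div s') := e1.symm

end ModelFrobenioid

end Literature.AlgebraicGeometry.Frobenioids

namespace Literature.AnabelianGeometry.EtaleTheta

open CategoryTheory Opposite Literature.AlgebraicGeometry.Frobenioids
open Literature.AlgebraicGeometry.Frobenioids.PreFrobenioid (pull_inv_pull_eq pull_pull_inv_eq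
  pull_injective pullGp_of' pullGp_inv_pullGp pullGp_pullGp_inv pullGp_injective)

universe u₀ v₀ u v w

variable {K : Type u₀} [Field K]

namespace BiKummerSetting

variable {X : SemiGraphs.TemperedArithmeticGroup.{u₀} K} {D₀ : Type u₀} [Category.{v₀} D₀]
  {V : FrdIMonoidStub.{w}} {T : RealifiedDivisorMonoids (D₀ := D₀) V} {D : Type u} [Category.{v} D]
  {VD : FrdICatStub.{u, v, w} D} {S : BiKummerSetting X T D VD}

namespace FractionPair

/-! ### Proposition 4.2 (i), sufficiency: composing a fraction-pair with an isomorphism -/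

/-- **Prop. 4.2 (i), sufficiency** ("immediate", p.89): if `(s', s'') : A → B` is a right fraction-pair
for `f`, then so is `(v ∘ s', v ∘ s'') : A → C` for every isomorphism `v : B ⥲ C` (pre-steps, base-
equivalent, the same fraction in `O^×(A^birat)` — via the dictionary — and the same divisors, `Φ`
divisorial). [cite: MochizukiEtTh2009, Prop 4.2(i) p.88] -/
theorem exists_comp_iso
    (hΦd : Objectwise (fun M _ => IsDivisorial M) S.tf.divisorMonoid)
    (hBg : Objectwise (fun M _ => IsGroupLike M) S.tf.ratFnFunctor)
    (toB : ∀ A : S.C, S.biratUnits A →* (S.tf.ratFnFunctor.obj (op A.base))ˣ)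
    (htoB : ∀ A : S.C, Function.Injective (toB A))
    (hfrac : ∀ {A B : S.C} (s' s'' : A ⟶ B) (h' : S.IsPreStep s') (h'' : S.IsPreStep s'')
      (hb : PreFrobenioid.BaseEquivalent S.F s' s''),
      (toB A (S.fracOf s' s'' h' h'' hb) : S.tf.ratFnFunctor.obj (op A.base)) *
        ModelFrobenioid.unit s'' = ModelFrobenioid.unit s')
    {A B C : S.C} {f : S.biratUnits A} (P : S.FractionPair f B) (v : B ≅ C) :
    ∃ Q : S.FractionPair f C, Q.num = P.num ≫ v.hom ∧ Q.den = P.den ≫ v.hom := by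
  haveI : IsCancelMul (S.tf.ratFnFunctor.obj (op A.base)) :=
    isIntegral_iff_isCancelMul.mp (hBg A.base).isPreDivisorial.isIntegral
  have h1 : S.IsPreStep (P.num ≫ v.hom) := ModelFrobenioid.isPreStep_comp_of_isIso P.isPreStep_num v.hom
  have h2 : S.IsPreStep (P.den ≫ v.hom) := ModelFrobenioid.isPreStep_comp_of_isIso P.isPreStep_den v.hom
  have hbP : ModelFrobenioid.baseMap P.num = ModelFrobenioid.baseMap P.den := P.base_eq
  have h3 : PreFrobenioid.BaseEquivalent S.F (P.num ≫ v.hom) (P.den ≫ v.hom) := by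
    change ModelFrobenioid.baseMap (P.num ≫ v.hom) = ModelFrobenioid.baseMap (P.den ≫ v.hom)
    rw [ModelFrobenioid.baseMap_comp, ModelFrobenioid.baseMap_comp, hbP]
  have hv : ModelFrobenioid.degFr v.hom = 1 := ModelFrobenioid.degFr_eq_one_of_isIso v.hom
  -- the fraction is unchanged
  have hfr : S.fracOf (P.num ≫ v.hom) (P.den ≫ v.hom) h1 h2 h3 = f := by
    have hx := hfrac (P.num ≫ v.hom) (P.den ≫ v.hom) h1 h2 h3
    have hy := hfrac P.num P.den P.isPreStep_num P.isPreStep_den P.base_eq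
    rw [P.frac_eq] at hy
    rw [ModelFrobenioid.unit_comp_of_degFr_eq_one _ hv, ModelFrobenioid.unit_comp_of_degFr_eq_one _ hv,
      ← hbP] at hx
    have key : pull S.tf.ratFnFunctor (ModelFrobenioid.baseMap P.num) (ModelFrobenioid.unit v.hom) *
        ((toB A (S.fracOf (P.num ≫ v.hom) (P.den ≫ v.hom) h1 h2 h3) : S.tf.ratFnFunctor.obj (op A.base)) *
          ModelFrobenioid.unit P.den) =
        pull S.tf.ratFnFunctor (ModelFrobenioid.baseMap P.num) (ModelFrobenioid.unit v.hom) *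
          ((toB A f : S.tf.ratFnFunctor.obj (op A.base)) * ModelFrobenioid.unit P.den) :=
      (mul_left_comm _ _ _).trans (hx.trans (congrArg _ hy.symm))
    exact htoB A (Units.ext (mul_right_cancel (mul_left_cancel key)))
  refine ⟨⟨P.num ≫ v.hom, P.den ≫ v.hom, h1, h2, h3, hfr, ?_⟩, rfl, rfl⟩
  change S.DisjointSupports (ModelFrobenioid.div (P.num ≫ v.hom)) (ModelFrobenioid.div (P.den ≫ v.hom))
  rw [ModelFrobenioid.div_comp_of_isIso hΦd, ModelFrobenioid.div_comp_of_isIso hΦd]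
  exact P.disjointSupports

/-! ### Proposition 4.2 (i), necessity and uniqueness -/

/-- **Prop. 4.2 (i), necessity and uniqueness** (p.88, proof p.89): two right fraction-pairs
`(s', s'') : A → B` and `(t', t'') : A → C` for the SAME `f ∈ O^×(A^birat)` differ by a unique
isomorphism `v : B ⥲ C`: `t' = v ∘ s'`, `t'' = v ∘ s''`.  Printed proof, formalised: the divisor of the
fraction gives `Div(s') − Div(s'') = Div(t') − Div(t'')`, whence (disjoint supports) `Div(s') = Div(t')`,
`Div(s'') = Div(t'')`; [FrdI] Def. 1.3 (iii)(d) for the model gives isomorphisms `v, v'''` with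
`t' = v ∘ s'`, `t'' = v''' ∘ s''`; base-equivalence makes `v''' = v'' ∘ v` with `v'' ∈ O^×(C)`, and the
equality of fractions forces `v'' = 1`; uniqueness since base-isomorphisms are epimorphisms.
[cite: MochizukiEtTh2009, Prop 4.2(i) p.88] -/
theorem existsUnique_iso
    (hΦd : Objectwise (fun M _ => IsDivisorial M) S.tf.divisorMonoid)
    (hBg : Objectwise (fun M _ => IsGroupLike M) S.tf.ratFnFunctor)
    (toB : ∀ A : S.C, S.biratUnits A →* (S.tf.ratFnFunctor.obj (op A.base))ˣ)
    (hfrac : ∀ {A B : S.C} (s' s'' : A ⟶ B) (h' : S.IsPreStep s') (h'' : S.IsPreStep s'')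
      (hb : PreFrobenioid.BaseEquivalent S.F s' s''),
      (toB A (S.fracOf s' s'' h' h'' hb) : S.tf.ratFnFunctor.obj (op A.base)) *
        ModelFrobenioid.unit s'' = ModelFrobenioid.unit s')
    (hDS : ∀ {A : Dᵒᵖ} {a b a' b' : S.tf.Φ.carrier A}, S.DisjointSupports a b →
      S.DisjointSupports a' b' → a * b' = a' * b → a = a' ∧ b = b')
    {A B C : S.C} {f : S.biratUnits A} (P : S.FractionPair f B) (Q : S.FractionPair f C) :
    ∃! v : B ≅ C, P.num ≫ v.hom = Q.num ∧ P.den ≫ v.hom = Q.den := by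
  haveI : IsCancelMul (S.tf.ratFnFunctor.obj (op A.base)) :=
    isIntegral_iff_isCancelMul.mp (hBg A.base).isPreDivisorial.isIntegral
  haveI : IsIso (ModelFrobenioid.baseMap P.num) := P.isPreStep_num.2
  haveI : IsIso (ModelFrobenioid.baseMap P.den) := P.isPreStep_den.2
  haveI : IsIso (ModelFrobenioid.baseMap Q.num) := Q.isPreStep_num.2
  haveI : IsIso (ModelFrobenioid.baseMap Q.den) := Q.isPreStep_den.2
  have hbP : ModelFrobenioid.baseMap P.num = ModelFrobenioid.baseMap P.den := P.base_eq
  have hbQ : ModelFrobenioid.baseMap Q.num = ModelFrobenioid.baseMap Q.den := Q.base_eq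
  -- Step 1: the divisors agree ("[Div(s'), Div(s'') are uniquely determined by f]")
  have hxP := hfrac P.num P.den P.isPreStep_num P.isPreStep_den P.base_eq
  have hxQ := hfrac Q.num Q.den Q.isPreStep_num Q.isPreStep_den Q.base_eq
  rw [P.frac_eq] at hxP
  rw [Q.frac_eq] at hxQ
  have dP := ModelFrobenioid.divB_mul_of_div_eq_of_mul_unit_eq P.num P.den hbP P.isPreStep_num.1
    P.isPreStep_den.1 hxP
  have dQ := ModelFrobenioid.divB_mul_of_div_eq_of_mul_unit_eq Q.num Q.den hbQ Q.isPreStep_num.1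
    Q.isPreStep_den.1 hxQ
  have hmul : ModelFrobenioid.div P.num * ModelFrobenioid.div Q.den =
      ModelFrobenioid.div Q.num * ModelFrobenioid.div P.den := by
    apply (hΦd A.base).isPreDivisorial.isIntegral.injective_of
    rw [map_mul, map_mul, ← dP, ← dQ]
    simp only [mul_comm, mul_left_comm]
  obtain ⟨hnum, hden⟩ := hDS P.disjointSupports Q.disjointSupports hmul
  -- Step 2: the isomorphisms `v`, `v'''`
  obtain ⟨v, hv⟩ := ModelFrobenioid.exists_iso_comp_eq_of_div_eq hBg P.num Q.num
    (P.isPreStep_num.1.trans Q.isPreStep_num.1.symm) hnum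
  obtain ⟨v₃, hv₃⟩ := ModelFrobenioid.exists_iso_comp_eq_of_div_eq hBg P.den Q.den
    (P.isPreStep_den.1.trans Q.isPreStep_den.1.symm) hden
  have hbv : ModelFrobenioid.baseMap v.hom = ModelFrobenioid.baseMap v₃.hom := by
    have e1 : ModelFrobenioid.baseMap P.num ≫ ModelFrobenioid.baseMap v.hom =
        ModelFrobenioid.baseMap Q.num := by rw [← ModelFrobenioid.baseMap_comp, hv]
    have e2 : ModelFrobenioid.baseMap P.den ≫ ModelFrobenioid.baseMap v₃.hom =
        ModelFrobenioid.baseMap Q.den := by rw [← ModelFrobenioid.baseMap_comp, hv₃]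
    rw [← hbP, ← hbQ, ← e1] at e2
    exact ((cancel_epi _).mp e2).symm
  -- Step 3: `v''' = v'' ∘ v` with `v'' ∈ O^×(C)`, and `v'' = 1` by comparing fractions
  have hw : v.symm ≪≫ v₃ ∈ S.units C := ModelFrobenioid.symm_trans_mem_units v v₃ hbv
  have hvd : ModelFrobenioid.degFr v.hom = 1 := ModelFrobenioid.degFr_eq_one_of_isIso v.hom
  have hden' : Q.den = (P.den ≫ v.hom) ≫ (v.symm ≪≫ v₃).hom := by
    rw [Iso.trans_hom, Iso.symm_hom, Category.assoc, Iso.hom_inv_id_assoc, hv₃]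
  have hw1 : v.symm ≪≫ v₃ = (1 : Aut C) := by
    apply ModelFrobenioid.eq_one_of_mem_units_of_unit_eq_one hΦd hw
    -- compare `x · u_{t''} = u_{t'}` with `x · u_{v ∘ s''} = u_{v ∘ s'}`
    have hx1 : (toB A f : S.tf.ratFnFunctor.obj (op A.base)) * ModelFrobenioid.unit (P.den ≫ v.hom) =
        ModelFrobenioid.unit (P.num ≫ v.hom) := by
      rw [ModelFrobenioid.unit_comp_of_degFr_eq_one _ hvd, ModelFrobenioid.unit_comp_of_degFr_eq_one _ hvd,
        ← hbP, mul_left_comm, hxP]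
    rw [← hv, hden', ModelFrobenioid.unit_comp_of_degFr_eq_one _ hw.2, ← mul_assoc,
      mul_right_comm, hx1] at hxQ
    -- hxQ : u_{v∘s'} * Base(v∘s'')^* u_w = u_{v∘s'}
    have hc : pull S.tf.ratFnFunctor (ModelFrobenioid.baseMap (P.den ≫ v.hom))
        (ModelFrobenioid.unit (v.symm ≪≫ v₃).hom) = 1 :=
      mul_left_cancel (hxQ.trans (mul_one _).symm)
    haveI : IsIso (ModelFrobenioid.baseMap (P.den ≫ v.hom)) :=
      (ModelFrobenioid.isPreStep_comp_of_isIso P.isPreStep_den v.hom).2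
    apply pull_injective (ModelFrobenioid.baseMap (P.den ≫ v.hom))
    rw [hc, map_one]
  refine ⟨v, ⟨hv, ?_⟩, ?_⟩
  · rw [hden', hw1]
    exact (Category.comp_id _).symm
  -- uniqueness: base-isomorphisms are epimorphisms
  · rintro v' ⟨hv', -⟩
    apply Iso.ext
    exact ModelFrobenioid.cancel_left_of_isIso_baseMap hΦd hBg P.num (hv'.trans hv.symm)

/-! ### Proposition 4.2 (ii): left fraction-pairs -/

/-- **Prop. 4.2 (ii), necessity and uniqueness** (p.88, proof p.89: "entirely similar [except that
one concludes uniqueness from the fact that pre-steps are always monomorphisms]"): a right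
fraction-pair `(s', s'') : A → B` for `f` and a left fraction-pair `(t', t'') : C → B` for `f|_B`
(i.e. a right fraction-pair for some `g ∈ O^×(C^birat)` with `g|_B = f|_B`) differ by a unique
isomorphism `v : C ⥲ A`: `t' = s' ∘ v`, `t'' = s'' ∘ v`.  The divisors are compared in `Φ(Base B)`
after transport along the base-isomorphisms `Base(s')`, `Base(t')` (whence the transport law `hDSι`
for disjoint supports), the isomorphisms come from the left version of [FrdI] Def. 1.3 (iii)(d) for the
model, and the unit `v''` is killed by the fraction identity for `g = Base(v)^* f`.
[cite: MochizukiEtTh2009, Prop 4.2(ii) p.88] -/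
theorem existsUnique_iso_left
    (hΦd : Objectwise (fun M _ => IsDivisorial M) S.tf.divisorMonoid)
    (hBg : Objectwise (fun M _ => IsGroupLike M) S.tf.ratFnFunctor)
    (toB : ∀ A : S.C, S.biratUnits A →* (S.tf.ratFnFunctor.obj (op A.base))ˣ)
    (hfrac : ∀ {A B : S.C} (s' s'' : A ⟶ B) (h' : S.IsPreStep s') (h'' : S.IsPreStep s'')
      (hb : PreFrobenioid.BaseEquivalent S.F s' s''),
      (toB A (S.fracOf s' s'' h' h'' hb) : S.tf.ratFnFunctor.obj (op A.base)) *
        ModelFrobenioid.unit s'' = ModelFrobenioid.unit s')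
    (hres : ∀ {A B : S.C} (s : A ⟶ B) (hs : S.IsPreStep s) (x : S.biratUnits A),
      pull S.tf.ratFnFunctor (ModelFrobenioid.baseMap s)
        (toB B (S.restrictAlong s hs x) : S.tf.ratFnFunctor.obj (op B.base)) =
        (toB A x : S.tf.ratFnFunctor.obj (op A.base)))
    (hDS : ∀ {A : Dᵒᵖ} {a b a' b' : S.tf.Φ.carrier A}, S.DisjointSupports a b →
      S.DisjointSupports a' b' → a * b' = a' * b → a = a' ∧ b = b')
    (hDSι : ∀ {A A' : D} (e : A' ⟶ A) [IsIso e] {a b : S.tf.Φ.carrier (op A)},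
      S.DisjointSupports a b →
        S.DisjointSupports (pull S.tf.divisorMonoid e a) (pull S.tf.divisorMonoid e b))
    {A B C : S.C} {f : S.biratUnits A} (P : S.FractionPair f B) {g : S.biratUnits C}
    (Q : S.FractionPair g B) (hPQ : Q.restrict = P.restrict) :
    ∃! v : C ≅ A, v.hom ≫ P.num = Q.num ∧ v.hom ≫ P.den = Q.den := by
  haveI : IsCancelMul (S.tf.ratFnFunctor.obj (op C.base)) :=
    isIntegral_iff_isCancelMul.mp (hBg C.base).isPreDivisorial.isIntegral
  haveI : IsIso (ModelFrobenioid.baseMap P.num) := P.isPreStep_num.2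
  haveI : IsIso (ModelFrobenioid.baseMap P.den) := P.isPreStep_den.2
  haveI : IsIso (ModelFrobenioid.baseMap Q.num) := Q.isPreStep_num.2
  haveI : IsIso (ModelFrobenioid.baseMap Q.den) := Q.isPreStep_den.2
  have hbP : ModelFrobenioid.baseMap P.num = ModelFrobenioid.baseMap P.den := P.base_eq
  have hbQ : ModelFrobenioid.baseMap Q.num = ModelFrobenioid.baseMap Q.den := Q.base_eq
  have hxP := hfrac P.num P.den P.isPreStep_num P.isPreStep_den P.base_eq
  have hxQ := hfrac Q.num Q.den Q.isPreStep_num Q.isPreStep_den Q.base_eq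
  rw [P.frac_eq] at hxP
  rw [Q.frac_eq] at hxQ
  -- the common element `r = f|_B = g|_B ∈ B(Base B)` and its pull-backs `f`, `g`
  have hrP : pull S.tf.ratFnFunctor (ModelFrobenioid.baseMap P.num)
      (toB B P.restrict : S.tf.ratFnFunctor.obj (op B.base)) = (toB A f : _) :=
    hres P.num P.isPreStep_num f
  have hrQ : pull S.tf.ratFnFunctor (ModelFrobenioid.baseMap Q.num)
      (toB B P.restrict : S.tf.ratFnFunctor.obj (op B.base)) = (toB C g : _) := by
    rw [← hPQ]
    exact hres Q.num Q.isPreStep_num g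
  -- Step 1: the transported divisors agree in `Φ(Base B)`
  have dP := ModelFrobenioid.divB_mul_of_div_eq_of_mul_unit_eq P.num P.den hbP P.isPreStep_num.1
    P.isPreStep_den.1 hxP
  have dQ := ModelFrobenioid.divB_mul_of_div_eq_of_mul_unit_eq Q.num Q.den hbQ Q.isPreStep_num.1
    Q.isPreStep_den.1 hxQ
  have dP' : divB S.tf.divisorMonoid S.tf.ratFnFunctor S.tf.divBNatTrans (op B.base)
        (toB B P.restrict : S.tf.ratFnFunctor.obj (op B.base)) *
      Algebra.GrothendieckGroup.of
        (pull S.tf.divisorMonoid (inv (ModelFrobenioid.baseMap P.num)) (ModelFrobenioid.div P.den)) =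
      Algebra.GrothendieckGroup.of
        (pull S.tf.divisorMonoid (inv (ModelFrobenioid.baseMap P.num)) (ModelFrobenioid.div P.num)) := by
    have h := congrArg (pullGp S.tf.divisorMonoid (inv (ModelFrobenioid.baseMap P.num))) dP
    rwa [map_mul, pullGp_of', pullGp_of', ModelFrobenioid.pullGp_divB_pull, ← hrP, pull_inv_pull_eq] at h
  have dQ' : divB S.tf.divisorMonoid S.tf.ratFnFunctor S.tf.divBNatTrans (op B.base)
        (toB B P.restrict : S.tf.ratFnFunctor.obj (op B.base)) *
      Algebra.GrothendieckGroup.of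
        (pull S.tf.divisorMonoid (inv (ModelFrobenioid.baseMap Q.num)) (ModelFrobenioid.div Q.den)) =
      Algebra.GrothendieckGroup.of
        (pull S.tf.divisorMonoid (inv (ModelFrobenioid.baseMap Q.num)) (ModelFrobenioid.div Q.num)) := by
    have h := congrArg (pullGp S.tf.divisorMonoid (inv (ModelFrobenioid.baseMap Q.num))) dQ
    rwa [map_mul, pullGp_of', pullGp_of', ModelFrobenioid.pullGp_divB_pull, ← hrQ, pull_inv_pull_eq] at h
  have hmul : pull S.tf.divisorMonoid (inv (ModelFrobenioid.baseMap P.num)) (ModelFrobenioid.div P.num) *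
        pull S.tf.divisorMonoid (inv (ModelFrobenioid.baseMap Q.num)) (ModelFrobenioid.div Q.den) =
      pull S.tf.divisorMonoid (inv (ModelFrobenioid.baseMap Q.num)) (ModelFrobenioid.div Q.num) *
        pull S.tf.divisorMonoid (inv (ModelFrobenioid.baseMap P.num)) (ModelFrobenioid.div P.den) := by
    apply (hΦd B.base).isPreDivisorial.isIntegral.injective_of
    rw [map_mul, map_mul, ← dP', ← dQ']
    simp only [mul_comm, mul_left_comm]
  obtain ⟨hnum, hden⟩ := hDS (hDSι (inv (ModelFrobenioid.baseMap P.num)) P.disjointSupports)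
    (hDSι (inv (ModelFrobenioid.baseMap Q.num)) Q.disjointSupports) hmul
  -- Step 2: the isomorphisms `v`, `v'''`
  obtain ⟨v, hv⟩ := ModelFrobenioid.exists_iso_comp_eq_of_pull_div_eq hBg P.num Q.num
    P.isPreStep_num.1 Q.isPreStep_num.1 hnum
  have hinvP : inv (ModelFrobenioid.baseMap P.num) = inv (ModelFrobenioid.baseMap P.den) :=
    IsIso.inv_eq_inv.mpr hbP
  have hinvQ : inv (ModelFrobenioid.baseMap Q.num) = inv (ModelFrobenioid.baseMap Q.den) :=
    IsIso.inv_eq_inv.mpr hbQ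
  rw [hinvP, hinvQ] at hden
  obtain ⟨v₃, hv₃⟩ := ModelFrobenioid.exists_iso_comp_eq_of_pull_div_eq hBg P.den Q.den
    P.isPreStep_den.1 Q.isPreStep_den.1 hden
  have e1 : ModelFrobenioid.baseMap v.hom ≫ ModelFrobenioid.baseMap P.num =
      ModelFrobenioid.baseMap Q.num := by rw [← ModelFrobenioid.baseMap_comp, hv]
  have hbv : ModelFrobenioid.baseMap v₃.hom = ModelFrobenioid.baseMap v.hom := by
    have e2 : ModelFrobenioid.baseMap v₃.hom ≫ ModelFrobenioid.baseMap P.den =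
        ModelFrobenioid.baseMap Q.den := by rw [← ModelFrobenioid.baseMap_comp, hv₃]
    rw [← hbP, ← hbQ, ← e1] at e2
    exact (cancel_mono _).mp e2
  -- Step 3: `v''' = v ∘ v''` with `v'' ∈ O^×(C)`; `v'' = 1` by comparing fractions
  have hw : v₃ ≪≫ v.symm ∈ S.units C := ModelFrobenioid.trans_symm_mem_units v₃ v hbv
  have hden' : Q.den = (v₃ ≪≫ v.symm).hom ≫ (v.hom ≫ P.den) := by
    rw [Iso.trans_hom, Iso.symm_hom, Category.assoc, Iso.inv_hom_id_assoc, hv₃]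
  have hw1 : v₃ ≪≫ v.symm = (1 : Aut C) := by
    apply ModelFrobenioid.eq_one_of_mem_units_of_unit_eq_one hΦd hw
    -- `g = Base(v)^* f`
    have hg : (toB C g : S.tf.ratFnFunctor.obj (op C.base)) =
        pull S.tf.ratFnFunctor (ModelFrobenioid.baseMap v.hom)
          (toB A f : S.tf.ratFnFunctor.obj (op A.base)) := by
      rw [← hrQ, ← hrP, ← pull_comp, e1]
    -- `u_{s' ∘ v} = Base(v)^* u_{s'} · u_v`, `u_{s'' ∘ v ∘ v''} = Base(v)^* u_{s''} · u_v · u_{v''}`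
    have hd1 : ModelFrobenioid.degFr P.den = 1 := P.isPreStep_den.1
    have hn1 : ModelFrobenioid.degFr P.num = 1 := P.isPreStep_num.1
    rw [← hv, hden', ModelFrobenioid.unit_comp_pull (v₃ ≪≫ v.symm).hom,
      ModelFrobenioid.pull_baseMap_of_mem_units hw, ModelFrobenioid.degFr_comp, hd1,
      ModelFrobenioid.degFr_eq_one_of_isIso v.hom, mul_one, PNat.one_coe, pow_one,
      ModelFrobenioid.unit_comp_pull v.hom P.den, ModelFrobenioid.unit_comp_pull v.hom P.num, hd1, hn1,
      PNat.one_coe, pow_one, hg, ← hxP, map_mul] at hxQ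
    have key : pull S.tf.ratFnFunctor (ModelFrobenioid.baseMap v.hom)
          (toB A f : S.tf.ratFnFunctor.obj (op A.base)) *
        pull S.tf.ratFnFunctor (ModelFrobenioid.baseMap v.hom) (ModelFrobenioid.unit P.den) *
        ModelFrobenioid.unit v.hom * ModelFrobenioid.unit (v₃ ≪≫ v.symm).hom =
        pull S.tf.ratFnFunctor (ModelFrobenioid.baseMap v.hom)
          (toB A f : S.tf.ratFnFunctor.obj (op A.base)) *
        pull S.tf.ratFnFunctor (ModelFrobenioid.baseMap v.hom) (ModelFrobenioid.unit P.den) *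
        ModelFrobenioid.unit v.hom * 1 := by
      rw [mul_one]
      calc _ = pull S.tf.ratFnFunctor (ModelFrobenioid.baseMap v.hom)
              (toB A f : S.tf.ratFnFunctor.obj (op A.base)) *
            (pull S.tf.ratFnFunctor (ModelFrobenioid.baseMap v.hom) (ModelFrobenioid.unit P.den) *
              ModelFrobenioid.unit v.hom * ModelFrobenioid.unit (v₃ ≪≫ v.symm).hom) := by
            simp only [mul_assoc]
        _ = _ := hxQ
    exact mul_left_cancel key
  refine ⟨v, ⟨hv, ?_⟩, ?_⟩
  · rw [hden', hw1]
    exact (Category.id_comp _).symm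
  -- uniqueness: pre-steps are monomorphisms
  · rintro v' ⟨hv', -⟩
    apply Iso.ext
    exact ModelFrobenioid.cancel_right_of_degFr_eq_one hΦd hBg P.num P.isPreStep_num.1 (hv'.trans hv.symm)

end FractionPair

end BiKummerSetting

end Literature.AnabelianGeometry.EtaleTheta

end
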